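import Literature.NumberTheory.EllipticCurves.KleinFrickeLevelNine
import Literature.NumberTheory.EllipticCurves.Isogeny
import HarnessLib

/-!
# Klein–Fricke at level 7 from a torsion point, with the value of the Hauptmodul

For an elliptic curve `W` over a field `F`, a Galois extension `L/F` and a point
`P = (x, y) ∈ W(L)` of order `7` whose cyclic subgroup `ℤP` is `Gal(L/F)`-stable, there is `η ∈ F`
with

  `j(W) · η = (η² + 13η + 49)(η² + 5η + 1)³`

— Fricke's rational modular equation of level `7`, Maier's canonical Hauptmodul
`t₇ = 7²([7]/[1])⁴` of `X₀(7)` (R. S. Maier, *On rationally parametrized modular equations*,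
J. Ramanujan Math. Soc. **24** (2009) = arXiv:math/0611041, Table 4, `N = 7`) — AND the value of
`η` is pinned down by the Tate parameter `d = d(P)` of the pair `(W, P)`:
`η · d(d - 1) = d³ - 8d² + 5d + 1` (`exists_hauptmodul_seven_of_torsion`,
`hauptmodul_seven_of_torsion_some`). This is the level-`7` sibling of
`KleinFrickeLevelNine` (`exists_hauptmodul_nine_of_torsion`), proved from first principles by
the same method; the value clause and the Kubert shape of the tangent-normalised coefficients
are what the level-`49` argument of Kenku's theorem consumes.

## Method (Tate normal form)

Move `P` to `(0,0)` with horizontal tangent: `W ≅ [A₁, A₂, A₃, 0, 0]` with `A₁ = a₁ + 2λ_P`,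
`A₂ = a₂ - λ_P a₁ + 3x_P - λ_P²`, `A₃ = y_P - ȳ_P` (`tgA₁`, `tgA₂`, `tgA₃` of
`KleinFrickeLevelNine`). Tate's coordinates of `(W, P)` are `b = -A₂³/A₃²`, `c = (A₃ - A₁A₂)/A₃`
(`W ≅ E(b, c) : y² + (1-c)xy - by = x³ - bx²`), and on `X₁(7)` one has `c = d² - d`,
`b = d³ - d²` (Kubert, *Universal bounds on the torsion of elliptic curves*, Proc. LMS 33
(1976), Table 3, `N = 7`) with `d = b/c = -A₂³/(A₃(A₃ - A₁A₂))` (`tateSeven`). The order-`7`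
condition `2·(2P₀) = -(3P₀)` is the single relation `a₂³R = a₃C³`, `C = a₃ - a₁a₂`,
`R = a₂³ - a₁a₂a₃ + a₃²` (`tate_relation_of_order_seven`, from the chord-and-tangent formulae;
in Tate's coordinates `c³ = b² - bc`), whence `a₁ = u(1 - d(d-1))`, `a₂ = -u²d²(d-1)`,
`a₃ = -u³d²(d-1)` with `u = a₃/a₂` (`tate_parametrisation_seven`), then
`Δ = u¹² d⁷(d-1)⁷(d³-8d²+5d+1)`, `c₄ = u⁴(d²-d+1)(d⁶-11d⁵+30d⁴-15d³-10d²+5d+1)`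
(`j_mul_tateSeven_normal`); the deck transformation `P ↦ 2P` of `X₁(7) → X₀(7)` acts by
`d(2P) = (d(P) - 1)/d(P)` (order `3`; `tateSeven_double_normal`, `tateSeven_of_order_seven`),
`d(-P) = d(P)`, `σ d(P) = d(σP)`, so `η = (d³ - 8d² + 5d + 1)/(d(d-1)) = d + d' + d'' - 8` (sum
over the deck orbit) is `Gal(L/F)`-invariant and descends
(`InfiniteGalois.mem_range_algebraMap_iff_fixed`). All identities are checked by
`ring`/`linear_combination`. [cite: Kubert1976, Table 3 (N = 7); Maier2006, Table 4 (N = 7)]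
-/

noncomputable section

open scoped Classical

namespace WeierstrassCurve

universe u

variable {F : Type u} [Field F] (W : WeierstrassCurve F) {L : Type u} [Field L] [Algebra F L]

/-! ### §1. Tate's parameter `d` of the pair `(W, P)` -/

section Defs

/-- Tate's parameter `d(P) = b/c = -A₂³/(A₃(A₃ - A₁A₂))` of the pair `(W, P)` (`b = -A₂³/A₃²`,
`c = (A₃ - A₁A₂)/A₃` the coefficients of the Tate normal form `E(b, c)` of `W` at `P`); for `P` of
order `7` it is Kubert's coordinate on `X₁(7)` (`c = d² - d`, `b = d³ - d²`).
[cite: Kubert1976, Table 3 (N = 7)] -/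
def tateSeven (x y : F) : F :=
  -(W.tgA₂ x y) ^ 3 / (W.tgA₃ x y * (W.tgA₃ x y - W.tgA₁ x y * W.tgA₂ x y))

end Defs

variable {W}

/-! ### §2. `d` at the origin of a normal form, under negation, under `u = 1` changes, under Galois -/

section Basic

/-- `d(0,0) = -a₂³/(a₃(a₃ - a₁a₂))` on `[a₁, a₂, a₃, 0, 0]` (`a₃ ≠ 0`). [folklore] -/
theorem tateSeven_origin (h4 : W.a₄ = 0) (h3 : W.a₃ ≠ 0) :
    W.tateSeven 0 0 = -W.a₂ ^ 3 / (W.a₃ * (W.a₃ - W.a₁ * W.a₂)) := by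
  rw [tateSeven, tgA₁_origin h4 h3, tgA₂_origin h4 h3, tgA₃_origin]

/-- `d(-P) = d(P)` (`A₁ ↦ -A₁`, `A₂ ↦ A₂`, `A₃ ↦ -A₃`). [folklore] -/
theorem tateSeven_negY {x y : F} (hy : y ≠ W.toAffine.negY x y) :
    W.tateSeven x (W.toAffine.negY x y) = W.tateSeven x y := by
  rw [tateSeven, tateSeven, tgA₁_negY hy, tgA₂_negY hy, tgA₃_negY]
  congr 1
  ring

/-- `d` is unchanged by a change of variables with `u = 1`. [folklore] -/
theorem tateSeven_toXY (C : VariableChange F) (hu : C.u = 1) {x y : F}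
    (h : W.toAffine.Equation x y) (hy : y ≠ W.toAffine.negY x y) :
    (C • W).tateSeven (C.toX x) (C.toY x y) = W.tateSeven x y := by
  rw [tateSeven, tateSeven, tgA₁_toXY C hu h hy, tgA₂_toXY C hu h hy, tgA₃_toXY C hu]

/-- `d` is Galois-equivariant: `σ(d(x, y)) = d(σx, σy)` on `W_L` (`W` defined over `F`). [folklore] -/
theorem map_tateSeven (σ : L →ₐ[F] L) (x y : L) :
    σ ((W.baseChange L).tateSeven x y) = (W.baseChange L).tateSeven (σ x) (σ y) := by
  have ha₁ : σ (W.baseChange L).a₁ = (W.baseChange L).a₁ := σ.commutes W.a₁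
  have ha₂ : σ (W.baseChange L).a₂ = (W.baseChange L).a₂ := σ.commutes W.a₂
  simp only [tateSeven, tgA₁, tgA₂, tgA₃, map_div₀, map_neg, map_pow, map_sub, map_add, map_mul,
    map_ofNat, ha₁, ha₂, Affine.baseChange_slope, Affine.baseChange_negY]

end Basic

/-! ### §3. The order-`7` relation on `[a₁, a₂, a₃, 0, 0]` and Kubert's parametrisation -/

section Family

/-- **Order `7` criterion.** On `[a₁, a₂, a₃, 0, 0]` (`a₃ ≠ 0`), put `P₀ = (0,0)`. If
`2P₀ ≠ -P₀` and `2·(2P₀) = -(3P₀)` (so `P₀` has order `7`) then `a₂ ≠ 0` and, with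
`C = a₃ - a₁a₂`, `R = a₂³ - a₁a₂a₃ + a₃²`, the **`X₁(7)` relation** `a₂³R = a₃C³` holds (in Tate's
coordinates `b = -a₂³/a₃²`, `c = C/a₃`: `c³ = b² - bc`, Kubert's `X₁(7)`). Proof: with
`Q = 2P₀ = (-a₂, a₁a₂ - a₃)` and `x(3P₀) = a₃C/a₂²`, the identity
`(x(2Q) - x(3P₀))·a₂²C² = a₂³R - a₃C³`. [folklore] -/
theorem tate_relation_of_order_seven (h4 : W.a₄ = 0) (h6 : W.a₆ = 0) (h3 : W.a₃ ≠ 0)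
    (hne : (Affine.Point.some _ _ (nonsingular_origin_of_a₃_ne_zero h6 h3) : W.toAffine.Point) +
        Affine.Point.some _ _ (nonsingular_origin_of_a₃_ne_zero h6 h3) ≠
        -Affine.Point.some _ _ (nonsingular_origin_of_a₃_ne_zero h6 h3))
    (h7 : ((Affine.Point.some _ _ (nonsingular_origin_of_a₃_ne_zero h6 h3) : W.toAffine.Point) +
        Affine.Point.some _ _ (nonsingular_origin_of_a₃_ne_zero h6 h3)) +
        ((Affine.Point.some _ _ (nonsingular_origin_of_a₃_ne_zero h6 h3) : W.toAffine.Point) +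
        Affine.Point.some _ _ (nonsingular_origin_of_a₃_ne_zero h6 h3)) =
        -((Affine.Point.some _ _ (nonsingular_origin_of_a₃_ne_zero h6 h3) : W.toAffine.Point) +
        ((Affine.Point.some _ _ (nonsingular_origin_of_a₃_ne_zero h6 h3) : W.toAffine.Point) +
          Affine.Point.some _ _ (nonsingular_origin_of_a₃_ne_zero h6 h3)))) :
    W.a₂ ≠ 0 ∧
      W.a₂ ^ 3 * (W.a₂ ^ 3 - W.a₁ * W.a₂ * W.a₃ + W.a₃ ^ 2) = W.a₃ * (W.a₃ - W.a₁ * W.a₂) ^ 3 := by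
  obtain ⟨hQ, h2P⟩ := two_smul_zero_zero h4 h6 h3
  -- `a₂ ≠ 0`: otherwise `2P₀ = (0, -a₃) = -P₀`
  have h2 : W.a₂ ≠ 0 := by
    intro ha
    apply hne
    rw [h2P, Affine.Point.neg_some]
    congr 1
    · rw [ha, neg_zero]
    · simp [Affine.negY, ha]
  refine ⟨h2, ?_⟩
  obtain ⟨hT, h3P⟩ := three_smul_zero_zero h4 h6 h3 h2
  rw [h3P, h2P] at h7
  have hnegY : W.toAffine.negY (-W.a₂) (W.a₁ * W.a₂ - W.a₃) = 0 := by
    simp only [Affine.negY]; ring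
  -- `C ≠ 0`: otherwise `Q = -Q`, `2Q = O ≠ -(3P₀)`
  have hD : W.a₁ * W.a₂ - W.a₃ ≠ 0 := by
    intro hD
    have hyQ : W.a₁ * W.a₂ - W.a₃ = W.toAffine.negY (-W.a₂) (W.a₁ * W.a₂ - W.a₃) := by
      rw [hnegY, hD]
    rw [Affine.Point.add_self_of_Y_eq hyQ, Affine.Point.neg_some] at h7
    exact Affine.Point.some_ne_zero _ h7.symm
  have hyQ : W.a₁ * W.a₂ - W.a₃ ≠ W.toAffine.negY (-W.a₂) (W.a₁ * W.a₂ - W.a₃) := by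
    rwa [hnegY]
  rw [Affine.Point.add_self_of_Y_ne hyQ, Affine.Point.neg_some] at h7
  have hx := ((Affine.Point.some.injEq _ _ _ _ _ _).mp h7).1
  -- `λ_Q (a₁a₂ - a₃) = a₂² - a₁²a₂ + a₁a₃`, `x(2Q) = λ_Q² + a₁λ_Q + a₂`
  set Λ := W.toAffine.slope (-W.a₂) (-W.a₂) (W.a₁ * W.a₂ - W.a₃) (W.a₁ * W.a₂ - W.a₃) with hΛ
  have hL : Λ * (W.a₁ * W.a₂ - W.a₃) = W.a₂ ^ 2 - W.a₁ ^ 2 * W.a₂ + W.a₁ * W.a₃ := by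
    rw [hΛ, Affine.slope_of_Y_ne rfl hyQ, hnegY, sub_zero, div_mul_cancel₀ _ hD]
    simp only [h4]
    ring
  simp only [Affine.addX] at hx
  have hx' : (Λ ^ 2 + W.a₁ * Λ + W.a₂) * W.a₂ ^ 2 = W.a₃ * (W.a₃ - W.a₁ * W.a₂) := by
    rw [← eq_div_iff (pow_ne_zero 2 h2), ← hx]
    ring
  -- clear denominators in `x(2Q) = x(3P₀)`
  linear_combination (W.a₁ * W.a₂ - W.a₃) ^ 2 * hx' -
    W.a₂ ^ 2 * ((W.a₂ ^ 2 - W.a₁ ^ 2 * W.a₂ + W.a₁ * W.a₃) + Λ * (W.a₁ * W.a₂ - W.a₃) +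
      W.a₁ * (W.a₁ * W.a₂ - W.a₃)) * hL

/-- **Kubert's parametrisation of `X₁(7)`.** On `[a₁, a₂, a₃, 0, 0]` with `a₂a₃ ≠ 0` and the
`X₁(7)` relation `a₂³R = a₃C³` (`C = a₃ - a₁a₂`, `R = a₂³ - a₁a₂a₃ + a₃²`): `C ≠ 0`, and with
`d := -a₂³/(a₃C)` (Tate's `b/c`), `u := a₃/a₂` one has `d ≠ 0`, `d ≠ 1` and
`a₁ = u(1 - d(d-1))`, `a₂ = -u²d²(d-1)`, `a₃ = -u³d²(d-1)`, i.e. the curve is `E(b, c)` scaled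
by `u` with `c = d² - d`, `b = d³ - d²`. [cite: Kubert1976, Table 3 (N = 7)] -/
theorem tate_parametrisation_seven (h2 : W.a₂ ≠ 0) (h3 : W.a₃ ≠ 0)
    (hrel : W.a₂ ^ 3 * (W.a₂ ^ 3 - W.a₁ * W.a₂ * W.a₃ + W.a₃ ^ 2) =
      W.a₃ * (W.a₃ - W.a₁ * W.a₂) ^ 3) :
    W.a₃ - W.a₁ * W.a₂ ≠ 0 ∧
      -W.a₂ ^ 3 / (W.a₃ * (W.a₃ - W.a₁ * W.a₂)) ≠ 0 ∧
      -W.a₂ ^ 3 / (W.a₃ * (W.a₃ - W.a₁ * W.a₂)) - 1 ≠ 0 ∧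
      W.a₁ = W.a₃ / W.a₂ *
          (1 - -W.a₂ ^ 3 / (W.a₃ * (W.a₃ - W.a₁ * W.a₂)) *
            (-W.a₂ ^ 3 / (W.a₃ * (W.a₃ - W.a₁ * W.a₂)) - 1)) ∧
      W.a₂ = -((W.a₃ / W.a₂) ^ 2 *
          ((-W.a₂ ^ 3 / (W.a₃ * (W.a₃ - W.a₁ * W.a₂))) ^ 2 *
            (-W.a₂ ^ 3 / (W.a₃ * (W.a₃ - W.a₁ * W.a₂)) - 1))) ∧
      W.a₃ = -((W.a₃ / W.a₂) ^ 3 *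
          ((-W.a₂ ^ 3 / (W.a₃ * (W.a₃ - W.a₁ * W.a₂))) ^ 2 *
            (-W.a₂ ^ 3 / (W.a₃ * (W.a₃ - W.a₁ * W.a₂)) - 1))) := by
  obtain ⟨c, hc⟩ : ∃ c : F, c = W.a₃ - W.a₁ * W.a₂ := ⟨_, rfl⟩
  rw [← hc] at hrel ⊢
  -- `C ≠ 0`: else `R = a₂³` and the relation reads `a₂⁶ = 0`
  have hc0 : c ≠ 0 := by
    intro h0
    rw [h0] at hrel hc
    have h' : (W.a₂ ^ 3) ^ 2 = 0 := by
      linear_combination hrel + W.a₂ ^ 3 * W.a₃ * hc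
    exact h2 ((pow_eq_zero_iff (by norm_num : (3 : ℕ) ≠ 0)).1
      ((pow_eq_zero_iff (by norm_num : (2 : ℕ) ≠ 0)).1 h'))
  obtain ⟨d, hd⟩ : ∃ d : F, d = -W.a₂ ^ 3 / (W.a₃ * c) := ⟨_, rfl⟩
  obtain ⟨u, hu⟩ : ∃ u : F, u = W.a₃ / W.a₂ := ⟨_, rfl⟩
  rw [← hd, ← hu]
  have h3c : W.a₃ * c ≠ 0 := mul_ne_zero h3 hc0
  have hd0 : d ≠ 0 := hd ▸ div_ne_zero (neg_ne_zero.2 (pow_ne_zero 3 h2)) h3c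
  have hdC : d * (W.a₃ * c) = -W.a₂ ^ 3 := by rw [hd, div_mul_cancel₀ _ h3c]
  -- the key consequence of the relation: `a₃ d(d - 1) = C` (i.e. Tate's `c = d² - d`)
  have hcd : W.a₃ * (d * (d - 1)) = c := by
    have e : (W.a₃ * (d * (d - 1)) - c) * (W.a₃ * c) ^ 2 = 0 := by
      linear_combination (W.a₃ * (d * (W.a₃ * c) - W.a₂ ^ 3) - W.a₃ ^ 2 * c) * hdC +
        W.a₃ * hrel + W.a₃ ^ 2 * W.a₂ ^ 3 * hc
    exact sub_eq_zero.1 ((mul_eq_zero.1 e).resolve_right (pow_ne_zero 2 h3c))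
  have hd1 : d - 1 ≠ 0 := by
    intro h1
    rw [h1, mul_zero, mul_zero] at hcd
    exact hc0 hcd.symm
  -- `a₂³ = -a₃² d²(d-1)` (i.e. Tate's `b = d³ - d²`)
  have I3 : W.a₂ ^ 3 = -(W.a₃ ^ 2 * (d ^ 2 * (d - 1))) := by
    linear_combination hdC + W.a₃ * d * hcd
  refine ⟨hc0, hd0, hd1, ?_, ?_, ?_⟩
  · rw [hu, div_mul_eq_mul_div, eq_div_iff h2]
    linear_combination hcd + hc
  · rw [hu, div_pow, div_mul_eq_mul_div, ← neg_div, eq_div_iff (pow_ne_zero 2 h2)]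
    linear_combination I3
  · rw [hu, div_pow, div_mul_eq_mul_div, ← neg_div, eq_div_iff (pow_ne_zero 3 h2)]
    linear_combination W.a₃ * I3

/-- **The `X₀(7)`-side of the normal form.** On `[a₁, a₂, a₃, 0, 0]` elliptic with `a₂a₃ ≠ 0`
and the `X₁(7)` relation, with `d = -a₂³/(a₃C)` Tate's parameter:
`Δ = u¹² d⁷(d-1)⁷(d³-8d²+5d+1)` and `c₄ = u⁴(d²-d+1)(d⁶-11d⁵+30d⁴-15d³-10d²+5d+1)`, so
`d³ - 8d² + 5d + 1 ≠ 0` and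
`j · d⁷(d-1)⁷(d³-8d²+5d+1) = (d²-d+1)³(d⁶-11d⁵+30d⁴-15d³-10d²+5d+1)³` (the `j`-invariant of
Tate's `E(d³-d², d²-d)` over `X₁(7)`). [folklore] -/
theorem j_mul_tateSeven_normal [W.IsElliptic] (h4 : W.a₄ = 0) (h6 : W.a₆ = 0) (h2 : W.a₂ ≠ 0)
    (h3 : W.a₃ ≠ 0)
    (hrel : W.a₂ ^ 3 * (W.a₂ ^ 3 - W.a₁ * W.a₂ * W.a₃ + W.a₃ ^ 2) =
      W.a₃ * (W.a₃ - W.a₁ * W.a₂) ^ 3) :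
    (-W.a₂ ^ 3 / (W.a₃ * (W.a₃ - W.a₁ * W.a₂))) ^ 3 -
          8 * (-W.a₂ ^ 3 / (W.a₃ * (W.a₃ - W.a₁ * W.a₂))) ^ 2 +
          5 * (-W.a₂ ^ 3 / (W.a₃ * (W.a₃ - W.a₁ * W.a₂))) + 1 ≠ 0 ∧
      W.j * ((-W.a₂ ^ 3 / (W.a₃ * (W.a₃ - W.a₁ * W.a₂))) ^ 7 *
          (-W.a₂ ^ 3 / (W.a₃ * (W.a₃ - W.a₁ * W.a₂)) - 1) ^ 7 *
          ((-W.a₂ ^ 3 / (W.a₃ * (W.a₃ - W.a₁ * W.a₂))) ^ 3 -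
            8 * (-W.a₂ ^ 3 / (W.a₃ * (W.a₃ - W.a₁ * W.a₂))) ^ 2 +
            5 * (-W.a₂ ^ 3 / (W.a₃ * (W.a₃ - W.a₁ * W.a₂))) + 1)) =
        ((-W.a₂ ^ 3 / (W.a₃ * (W.a₃ - W.a₁ * W.a₂))) ^ 2 -
            -W.a₂ ^ 3 / (W.a₃ * (W.a₃ - W.a₁ * W.a₂)) + 1) ^ 3 *
          ((-W.a₂ ^ 3 / (W.a₃ * (W.a₃ - W.a₁ * W.a₂))) ^ 6 -
            11 * (-W.a₂ ^ 3 / (W.a₃ * (W.a₃ - W.a₁ * W.a₂))) ^ 5 +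
            30 * (-W.a₂ ^ 3 / (W.a₃ * (W.a₃ - W.a₁ * W.a₂))) ^ 4 -
            15 * (-W.a₂ ^ 3 / (W.a₃ * (W.a₃ - W.a₁ * W.a₂))) ^ 3 -
            10 * (-W.a₂ ^ 3 / (W.a₃ * (W.a₃ - W.a₁ * W.a₂))) ^ 2 +
            5 * (-W.a₂ ^ 3 / (W.a₃ * (W.a₃ - W.a₁ * W.a₂))) + 1) ^ 3 := by
  obtain ⟨-, hd0, hd1, ha₁, ha₂, ha₃⟩ := tate_parametrisation_seven h2 h3 hrel
  obtain ⟨u, hu⟩ : ∃ u : F, u = W.a₃ / W.a₂ := ⟨_, rfl⟩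
  obtain ⟨d, hd⟩ : ∃ d : F, d = -W.a₂ ^ 3 / (W.a₃ * (W.a₃ - W.a₁ * W.a₂)) := ⟨_, rfl⟩
  rw [← hu, ← hd] at ha₁ ha₂ ha₃
  rw [← hd] at hd0 hd1 ⊢
  have hu0 : u ≠ 0 := hu ▸ div_ne_zero h3 h2
  have hΔ : W.Δ = u ^ 12 * (d ^ 7 * (d - 1) ^ 7 * (d ^ 3 - 8 * d ^ 2 + 5 * d + 1)) := by
    simp only [WeierstrassCurve.Δ, WeierstrassCurve.b₂, WeierstrassCurve.b₄, WeierstrassCurve.b₆,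
      WeierstrassCurve.b₈, h4, h6]
    rw [ha₁, ha₂, ha₃]
    ring
  have hΔ0 : W.Δ ≠ 0 := W.isUnit_Δ.ne_zero
  rw [hΔ] at hΔ0
  have hD : d ^ 3 - 8 * d ^ 2 + 5 * d + 1 ≠ 0 := fun h => hΔ0 (by rw [h]; ring)
  refine ⟨hD, ?_⟩
  have hc₄ : W.c₄ = u ^ 4 * ((d ^ 2 - d + 1) *
      (d ^ 6 - 11 * d ^ 5 + 30 * d ^ 4 - 15 * d ^ 3 - 10 * d ^ 2 + 5 * d + 1)) := by
    simp only [WeierstrassCurve.c₄, WeierstrassCurve.b₂, WeierstrassCurve.b₄, h4]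
    rw [ha₁, ha₂, ha₃]
    ring
  rw [WeierstrassCurve.j, Units.val_inv_eq_inv_val, WeierstrassCurve.coe_Δ', hΔ, hc₄]
  have hX : d ^ 7 * (d - 1) ^ 7 * (d ^ 3 - 8 * d ^ 2 + 5 * d + 1) ≠ 0 :=
    mul_ne_zero (mul_ne_zero (pow_ne_zero 7 hd0) (pow_ne_zero 7 hd1)) hD
  generalize d ^ 7 * (d - 1) ^ 7 * (d ^ 3 - 8 * d ^ 2 + 5 * d + 1) = X at hX ⊢
  field_simp

/-- **The deck transformation `P ↦ 2P` of `X₁(7) → X₀(7)` in Tate's coordinate.** On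
`[a₁, a₂, a₃, 0, 0]` with `a₂a₃ ≠ 0` and the `X₁(7)` relation, Tate's parameter at
`Q = 2P₀ = (-a₂, a₁a₂ - a₃)` is `d(Q) = (d - 1)/d`, `d = d(P₀)` (a Möbius transformation of
order `3`: `d ↦ 1 - 1/d ↦ -1/(d - 1) ↦ d`; `(ℤ/7)ˣ/±1` is generated by `2`). The tangent data
at `Q`: slope `u(d² - 1)`, `A₁ = u(d² + d - 1)`, `A₂ = u²d(d-1)²`, `A₃ = u³d³(d-1)²`.
[folklore] -/
theorem tateSeven_double_normal (h4 : W.a₄ = 0) (h2 : W.a₂ ≠ 0) (h3 : W.a₃ ≠ 0)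
    (hrel : W.a₂ ^ 3 * (W.a₂ ^ 3 - W.a₁ * W.a₂ * W.a₃ + W.a₃ ^ 2) =
      W.a₃ * (W.a₃ - W.a₁ * W.a₂) ^ 3) :
    W.tateSeven (-W.a₂) (W.a₁ * W.a₂ - W.a₃) =
      (-W.a₂ ^ 3 / (W.a₃ * (W.a₃ - W.a₁ * W.a₂)) - 1) /
        (-W.a₂ ^ 3 / (W.a₃ * (W.a₃ - W.a₁ * W.a₂))) := by
  obtain ⟨hc0, hd0, hd1, ha₁, ha₂, ha₃⟩ := tate_parametrisation_seven h2 h3 hrel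
  obtain ⟨u, hu⟩ : ∃ u : F, u = W.a₃ / W.a₂ := ⟨_, rfl⟩
  obtain ⟨d, hd⟩ : ∃ d : F, d = -W.a₂ ^ 3 / (W.a₃ * (W.a₃ - W.a₁ * W.a₂)) := ⟨_, rfl⟩
  rw [← hu, ← hd] at ha₁ ha₂ ha₃
  rw [← hd] at hd0 hd1 ⊢
  have hu0 : u ≠ 0 := hu ▸ div_ne_zero h3 h2
  have hD : W.a₁ * W.a₂ - W.a₃ ≠ 0 := fun h => hc0 (by linear_combination -h)
  have hnegY : W.toAffine.negY (-W.a₂) (W.a₁ * W.a₂ - W.a₃) = 0 := by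
    simp only [Affine.negY]; ring
  have hyQ : W.a₁ * W.a₂ - W.a₃ ≠ W.toAffine.negY (-W.a₂) (W.a₁ * W.a₂ - W.a₃) := by
    rwa [hnegY]
  have hL : W.toAffine.slope (-W.a₂) (-W.a₂) (W.a₁ * W.a₂ - W.a₃) (W.a₁ * W.a₂ - W.a₃) =
      u * (d ^ 2 - 1) := by
    rw [Affine.slope_of_Y_ne rfl hyQ, hnegY, sub_zero, div_eq_iff hD]
    simp only [h4, add_zero]
    rw [ha₁, ha₂, ha₃]
    ring
  have hA₁ : W.tgA₁ (-W.a₂) (W.a₁ * W.a₂ - W.a₃) = u * (d ^ 2 + d - 1) := by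
    rw [tgA₁, hL, ha₁]
    ring
  have hA₂ : W.tgA₂ (-W.a₂) (W.a₁ * W.a₂ - W.a₃) = u ^ 2 * (d * (d - 1) ^ 2) := by
    rw [tgA₂, hL, ha₁, ha₂]
    ring
  have hA₃ : W.tgA₃ (-W.a₂) (W.a₁ * W.a₂ - W.a₃) = u ^ 3 * (d ^ 3 * (d - 1) ^ 2) := by
    rw [tgA₃, hnegY, sub_zero, ha₁, ha₂, ha₃]
    ring
  rw [tateSeven, hA₁, hA₂, hA₃]
  have hden : u ^ 3 * (d ^ 3 * (d - 1) ^ 2) *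
      (u ^ 3 * (d ^ 3 * (d - 1) ^ 2) - u * (d ^ 2 + d - 1) * (u ^ 2 * (d * (d - 1) ^ 2))) =
      -(u ^ 6 * d ^ 4 * (d - 1) ^ 5) := by
    ring
  rw [hden, div_eq_div_iff (neg_ne_zero.2 (mul_ne_zero (mul_ne_zero (pow_ne_zero 6 hu0)
    (pow_ne_zero 4 hd0)) (pow_ne_zero 5 hd1))) hd0]
  ring

end Family

/-! ### §4. At a point of order `7`: `d ≠ 0, 1`, `d(2P) = (d(P) - 1)/d(P)`, `j`, Kubert's shape -/

section PointLevel

variable {V : WeierstrassCurve F}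

/-- **Tate's coordinate at a point of order `7`.** Let `P = (x₀, y₀)` be a point with `7P = O`
on `V` and `2P = (x₁, y₁)`. Then `d = d(P)` satisfies `d ≠ 0`, `d ≠ 1`, the
deck-transformation law `d(2P) = (d - 1)/d`, `d³ - 8d² + 5d + 1 ≠ 0` (`V` elliptic),
`j(V) d⁷(d-1)⁷(d³-8d²+5d+1) = (d²-d+1)³(d⁶-11d⁵+30d⁴-15d³-10d²+5d+1)³`, and the
tangent-normalised coefficients at `P` have Kubert's shape: `A₂A₃(A₃ - A₁A₂) ≠ 0`,
`A₁ = u(1 - d(d-1))`, `A₂ = -u²d²(d-1)`, `A₃ = -u³d²(d-1)` with `u = A₃/A₂` (normalise at `P`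
by `(1, x₀, λ_P, y₀)` and use §3). [cite: Kubert1976, Table 3 (N = 7)] -/
theorem tateSeven_of_order_seven [V.IsElliptic] {x₀ y₀ : F} {h : V.toAffine.Nonsingular x₀ y₀}
    (h7 : (7 : ℕ) • (Affine.Point.some _ _ h : V.toAffine.Point) = 0)
    {x₁ y₁ : F} {h₁ : V.toAffine.Nonsingular x₁ y₁}
    (hQ : (Affine.Point.some _ _ h : V.toAffine.Point) + .some _ _ h = .some _ _ h₁) :
    V.tateSeven x₀ y₀ ≠ 0 ∧ V.tateSeven x₀ y₀ - 1 ≠ 0 ∧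
      V.tateSeven x₁ y₁ = (V.tateSeven x₀ y₀ - 1) / V.tateSeven x₀ y₀ ∧
      V.tateSeven x₀ y₀ ^ 3 - 8 * V.tateSeven x₀ y₀ ^ 2 + 5 * V.tateSeven x₀ y₀ + 1 ≠ 0 ∧
      V.j * (V.tateSeven x₀ y₀ ^ 7 * (V.tateSeven x₀ y₀ - 1) ^ 7 *
          (V.tateSeven x₀ y₀ ^ 3 - 8 * V.tateSeven x₀ y₀ ^ 2 + 5 * V.tateSeven x₀ y₀ + 1)) =
        (V.tateSeven x₀ y₀ ^ 2 - V.tateSeven x₀ y₀ + 1) ^ 3 *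
          (V.tateSeven x₀ y₀ ^ 6 - 11 * V.tateSeven x₀ y₀ ^ 5 + 30 * V.tateSeven x₀ y₀ ^ 4 -
            15 * V.tateSeven x₀ y₀ ^ 3 - 10 * V.tateSeven x₀ y₀ ^ 2 +
            5 * V.tateSeven x₀ y₀ + 1) ^ 3 ∧
      V.tgA₂ x₀ y₀ ≠ 0 ∧ V.tgA₃ x₀ y₀ ≠ 0 ∧ V.tgA₃ x₀ y₀ - V.tgA₁ x₀ y₀ * V.tgA₂ x₀ y₀ ≠ 0 ∧
      V.tgA₁ x₀ y₀ = V.tgA₃ x₀ y₀ / V.tgA₂ x₀ y₀ *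
          (1 - V.tateSeven x₀ y₀ * (V.tateSeven x₀ y₀ - 1)) ∧
      V.tgA₂ x₀ y₀ = -((V.tgA₃ x₀ y₀ / V.tgA₂ x₀ y₀) ^ 2 *
          (V.tateSeven x₀ y₀ ^ 2 * (V.tateSeven x₀ y₀ - 1))) ∧
      V.tgA₃ x₀ y₀ = -((V.tgA₃ x₀ y₀ / V.tgA₂ x₀ y₀) ^ 3 *
          (V.tateSeven x₀ y₀ ^ 2 * (V.tateSeven x₀ y₀ - 1))) := by
  set P : V.toAffine.Point := .some _ _ h with hPdef
  -- consequences of `7P = O` in the group: `P ≠ -P`, `2P ≠ -P`, `2·(2P) = -(3P)`, `2P ≠ -2P`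
  have hy : y₀ ≠ V.toAffine.negY x₀ y₀ := by
    intro hyy
    have h2 : P + P = 0 := Affine.Point.add_self_of_Y_eq hyy
    rw [h2] at hQ
    exact Affine.Point.some_ne_zero _ hQ.symm
  have hne : P + P ≠ -P := by
    intro h2
    apply Affine.Point.some_ne_zero h
    have h3 : P + (P + P) = 0 := by rw [h2, add_neg_cancel]
    have e : P = (7 : ℕ) • P - (P + (P + P)) - (P + (P + P)) := by abel
    rw [← hPdef, e, h7, h3, sub_zero, sub_zero]
  have hT7 : (P + P) + (P + P) = -(P + (P + P)) := by
    apply eq_neg_of_add_eq_zero_left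
    have e : (P + P) + (P + P) + (P + (P + P)) = (7 : ℕ) • P := by abel
    rw [e, h7]
  have hy₁ : y₁ ≠ V.toAffine.negY x₁ y₁ := by
    intro hyy
    have h4 : (P + P) + (P + P) = 0 := by rw [hQ]; exact Affine.Point.add_self_of_Y_eq hyy
    apply Affine.Point.some_ne_zero h
    have e : P = (P + P) + (P + P) + ((P + P) + (P + P)) - (7 : ℕ) • P := by abel
    rw [← hPdef, e, h7, h4, sub_zero, add_zero]
  simp only [hPdef] at hne hT7 hQ
  -- normalise at `P`
  have hV' := variableChange_tangent_eq (W := V) h.1 hy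
  obtain ⟨h₀, hP'⟩ := pointEquiv_tangent_some (W := V) h
  have hQ' := VariableChange.pointEquiv_some V
    (⟨1, x₀, V.toAffine.slope x₀ x₀ y₀ y₀, y₀⟩ : VariableChange F) h₁
  have hd₀ := tateSeven_toXY (W := V) (⟨1, x₀, V.toAffine.slope x₀ x₀ y₀ y₀, y₀⟩ :
    VariableChange F) rfl h.1 hy
  have hd₁ := tateSeven_toXY (W := V) (⟨1, x₀, V.toAffine.slope x₀ x₀ y₀ y₀, y₀⟩ :
    VariableChange F) rfl h₁.1 hy₁
  have hA₁ : V.tgA₁ x₀ y₀ = ((⟨1, x₀, V.toAffine.slope x₀ x₀ y₀ y₀, y₀⟩ :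
      VariableChange F) • V).a₁ := by rw [hV', tgA₁]
  have hA₂ : V.tgA₂ x₀ y₀ = ((⟨1, x₀, V.toAffine.slope x₀ x₀ y₀ y₀, y₀⟩ :
      VariableChange F) • V).a₂ := by rw [hV', tgA₂]
  have hA₃ : V.tgA₃ x₀ y₀ = ((⟨1, x₀, V.toAffine.slope x₀ x₀ y₀ y₀, y₀⟩ :
      VariableChange F) • V).a₃ := by rw [hV', tgA₃]
  revert h₀ hP' hV' hQ' hd₀ hd₁ hA₁ hA₂ hA₃
  generalize (⟨1, x₀, V.toAffine.slope x₀ x₀ y₀ y₀, y₀⟩ : VariableChange F) = C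
  intro hV' h₀ hP' hQ' hd₀ hd₁ hA₁ hA₂ hA₃
  have h4' : (C • V).a₄ = 0 := by rw [hV']
  have h6' : (C • V).a₆ = 0 := by rw [hV']
  have h3' : (C • V).a₃ ≠ 0 := by rw [hV']; exact sub_ne_zero.2 hy
  -- transport the group-law facts to the normal form
  have hne' : VariableChange.pointEquiv V C (.some _ _ h + .some _ _ h) ≠
      VariableChange.pointEquiv V C (-.some _ _ h) :=
    fun e => hne ((VariableChange.pointEquiv V C).injective e)
  have hT7' := congrArg (VariableChange.pointEquiv V C) hT7
  simp only [map_add, map_neg, hP'] at hne' hT7'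
  obtain ⟨h2', hrel'⟩ := tate_relation_of_order_seven h4' h6' h3' hne' hT7'
  obtain ⟨hc0, hd0, hd1, ha₁, ha₂, ha₃⟩ := tate_parametrisation_seven h2' h3' hrel'
  -- `d(P)` is Tate's parameter of the normal form
  have hP'' := hP'
  rw [VariableChange.pointEquiv_some] at hP''
  obtain ⟨hX0, hY0⟩ := (Affine.Point.some.injEq _ _ _ _ _ _).mp hP''
  have hdP : V.tateSeven x₀ y₀ =
      -(C • V).a₂ ^ 3 / ((C • V).a₃ * ((C • V).a₃ - (C • V).a₁ * (C • V).a₂)) := by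
    rw [← hd₀, hX0, hY0, tateSeven_origin h4' h3']
  -- `d(2P)`: `2P ↦ (0,0) + (0,0) = (-a₂', a₁'a₂' - a₃')`
  have h2P := congrArg (VariableChange.pointEquiv V C) hQ
  rw [map_add, hP', hQ'] at h2P
  obtain ⟨hQ'', h2⟩ := two_smul_zero_zero h4' h6' h3'
  rw [h2] at h2P
  obtain ⟨hX1, hY1⟩ := (Affine.Point.some.injEq _ _ _ _ _ _).mp h2P
  have hdQ : V.tateSeven x₁ y₁ = (V.tateSeven x₀ y₀ - 1) / V.tateSeven x₀ y₀ := by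
    rw [← hd₁, ← hX1, ← hY1, tateSeven_double_normal h4' h2' h3' hrel', hdP]
  obtain ⟨hD, hj⟩ := j_mul_tateSeven_normal (W := C • V) h4' h6' h2' h3' hrel'
  rw [variableChange_j] at hj
  rw [hdP] at hdQ ⊢
  rw [hA₁, hA₂, hA₃]
  exact ⟨hd0, hd1, hdQ, hD, hj, h2', h3', hc0, ha₁, ha₂, ha₃⟩

end PointLevel

/-! ### §5. The Hauptmodul `η = (d³ - 8d² + 5d + 1)/(d(d - 1))` of `X₀(7)` -/

section Hauptmodul

/-- `η(d) = (d³ - 8d² + 5d + 1)/(d(d-1)) = d + d' + d'' - 8` (`d' = (d-1)/d`, `d'' = -1/(d-1)`)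
is invariant under the deck transformation `d ↦ (d - 1)/d`. [folklore] -/
theorem hauptmodul_seven_eq_of_double {z : F} (hz0 : z ≠ 0) (hz1 : z - 1 ≠ 0) :
    (((z - 1) / z) ^ 3 - 8 * ((z - 1) / z) ^ 2 + 5 * ((z - 1) / z) + 1) /
        ((z - 1) / z * ((z - 1) / z - 1)) =
      (z ^ 3 - 8 * z ^ 2 + 5 * z + 1) / (z * (z - 1)) := by
  have h1 : (z - 1) / z * ((z - 1) / z - 1) = -(z - 1) / z ^ 2 := by
    field_simp
    ring
  rw [h1, div_eq_div_iff (div_ne_zero (neg_ne_zero.2 hz1) (pow_ne_zero 2 hz0))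
    (mul_ne_zero hz0 hz1)]
  field_simp
  ring

/-- **From Tate's parameter to the Hauptmodul of `X₀(7)`.** If `d ≠ 0, 1`,
`d³ - 8d² + 5d + 1 ≠ 0` and `j d⁷(d-1)⁷(d³-8d²+5d+1) = (d²-d+1)³(d⁶-11d⁵+…+1)³`, then
`η := (d³ - 8d² + 5d + 1)/(d(d-1))` satisfies `j · η = (η² + 13η + 49)(η² + 5η + 1)³` — the
rational modular equation of level `7` (`η² + 13η + 49 = (d²-d+1)³/(d²(d-1)²)`,
`η² + 5η + 1 = (d⁶-11d⁵+30d⁴-15d³-10d²+5d+1)/(d²(d-1)²)`). [cite: Maier2006, Table 4 (N = 7)] -/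
theorem j_mul_hauptmodul_seven {j d : F} (hd0 : d ≠ 0) (hd1 : d - 1 ≠ 0)
    (hD : d ^ 3 - 8 * d ^ 2 + 5 * d + 1 ≠ 0)
    (hj : j * (d ^ 7 * (d - 1) ^ 7 * (d ^ 3 - 8 * d ^ 2 + 5 * d + 1)) =
      (d ^ 2 - d + 1) ^ 3 *
        (d ^ 6 - 11 * d ^ 5 + 30 * d ^ 4 - 15 * d ^ 3 - 10 * d ^ 2 + 5 * d + 1) ^ 3) :
    j * ((d ^ 3 - 8 * d ^ 2 + 5 * d + 1) / (d * (d - 1))) =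
      (((d ^ 3 - 8 * d ^ 2 + 5 * d + 1) / (d * (d - 1))) ^ 2 +
          13 * ((d ^ 3 - 8 * d ^ 2 + 5 * d + 1) / (d * (d - 1))) + 49) *
        (((d ^ 3 - 8 * d ^ 2 + 5 * d + 1) / (d * (d - 1))) ^ 2 +
          5 * ((d ^ 3 - 8 * d ^ 2 + 5 * d + 1) / (d * (d - 1))) + 1) ^ 3 := by
  have hdd : d * (d - 1) ≠ 0 := mul_ne_zero hd0 hd1
  have hX : d ^ 7 * (d - 1) ^ 7 * (d ^ 3 - 8 * d ^ 2 + 5 * d + 1) ≠ 0 :=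
    mul_ne_zero (mul_ne_zero (pow_ne_zero 7 hd0) (pow_ne_zero 7 hd1)) hD
  have hj' : j = (d ^ 2 - d + 1) ^ 3 *
      (d ^ 6 - 11 * d ^ 5 + 30 * d ^ 4 - 15 * d ^ 3 - 10 * d ^ 2 + 5 * d + 1) ^ 3 /
      (d ^ 7 * (d - 1) ^ 7 * (d ^ 3 - 8 * d ^ 2 + 5 * d + 1)) := by
    rw [eq_div_iff hX]
    exact hj
  have hd2 : d ^ 2 * (d - 1) ^ 2 ≠ 0 := mul_ne_zero (pow_ne_zero 2 hd0) (pow_ne_zero 2 hd1)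
  have hH1 : ((d ^ 3 - 8 * d ^ 2 + 5 * d + 1) / (d * (d - 1))) ^ 2 +
      13 * ((d ^ 3 - 8 * d ^ 2 + 5 * d + 1) / (d * (d - 1))) + 49 =
      (d ^ 2 - d + 1) ^ 3 / (d ^ 2 * (d - 1) ^ 2) := by
    rw [eq_div_iff hd2]
    field_simp
    ring
  have hH2 : ((d ^ 3 - 8 * d ^ 2 + 5 * d + 1) / (d * (d - 1))) ^ 2 +
      5 * ((d ^ 3 - 8 * d ^ 2 + 5 * d + 1) / (d * (d - 1))) + 1 =
      (d ^ 6 - 11 * d ^ 5 + 30 * d ^ 4 - 15 * d ^ 3 - 10 * d ^ 2 + 5 * d + 1) /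
        (d ^ 2 * (d - 1) ^ 2) := by
    rw [eq_div_iff hd2]
    field_simp
    ring
  rw [hj', hH1, hH2, div_pow, div_mul_div_comm, div_mul_div_comm,
    div_eq_div_iff (mul_ne_zero hX hdd) (mul_ne_zero hd2 (pow_ne_zero 3 hd2))]
  ring

end Hauptmodul

/-! ### §6. Galois descent: a stable cyclic subgroup of order `7` gives a point of `X₀(7)` -/

section Descent

/-- **A Galois-stable cyclic subgroup of order `7` gives an `F`-point of `X₀(7)`, with its
value** (Klein–Fricke, level `7`). Let `W/F` be an elliptic curve, `L/F` Galois, and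
`P = (x₀, y₀) ∈ W(L)` a point of order `7` whose cyclic subgroup `ℤP` is `Gal(L/F)`-stable. Then
there is `η ∈ F` with `j(W) · η = (η² + 13η + 49)(η² + 5η + 1)³`, the rational modular equation
of level `7` [cite: Maier2006, Table 4 (N = 7)], and `η · d(d-1) = d³ - 8d² + 5d + 1` for Tate's
parameter `d = d(P)`. Proof: `η = (d³-8d²+5d+1)/(d(d-1))` (§4–5); `σ` moves `d(P)` to
`d(σP) ∈ {d(±P), d(±2P), d(±4P)} = {d, (d-1)/d, -1/(d-1)}`, on which `η` is constant, so `η ∈ F`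
(`InfiniteGalois.mem_range_algebraMap_iff_fixed`). [folklore] -/
theorem exists_hauptmodul_seven_of_torsion [IsGalois F L] [W.IsElliptic] {x₀ y₀ : L}
    {h : (W.baseChange L).toAffine.Nonsingular x₀ y₀}
    (h7 : addOrderOf (Affine.Point.some _ _ h : (W.baseChange L).toAffine.Point) = 7)
    (hσ : ∀ σ : L ≃ₐ[F] L, σ • (Affine.Point.some _ _ h : (W.baseChange L).toAffine.Point) ∈
      AddSubgroup.zmultiples (Affine.Point.some _ _ h : (W.baseChange L).toAffine.Point)) :
    ∃ η : F, W.j * η = (η ^ 2 + 13 * η + 49) * (η ^ 2 + 5 * η + 1) ^ 3 ∧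
      algebraMap F L η *
          ((W.baseChange L).tateSeven x₀ y₀ * ((W.baseChange L).tateSeven x₀ y₀ - 1)) =
        (W.baseChange L).tateSeven x₀ y₀ ^ 3 - 8 * (W.baseChange L).tateSeven x₀ y₀ ^ 2 +
          5 * (W.baseChange L).tateSeven x₀ y₀ + 1 := by
  haveI : (W.baseChange L).IsElliptic := by rw [baseChange]; infer_instance
  -- order bookkeeping
  have h7P : (7 : ℕ) • (Affine.Point.some _ _ h : (W.baseChange L).toAffine.Point) = 0 :=
    h7 ▸ addOrderOf_nsmul_eq_zero _
  have hmul : ∀ k : ℕ, k • (Affine.Point.some _ _ h : (W.baseChange L).toAffine.Point) = 0 →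
      7 ∣ k :=
    fun k hk => h7 ▸ addOrderOf_dvd_of_nsmul_eq_zero hk
  have h2P : (2 : ℕ) • (Affine.Point.some _ _ h : (W.baseChange L).toAffine.Point) ≠ 0 :=
    fun e => by have := hmul 2 e; omega
  have h4P : (4 : ℕ) • (Affine.Point.some _ _ h : (W.baseChange L).toAffine.Point) ≠ 0 :=
    fun e => by have := hmul 4 e; omega
  have h8P : (8 : ℕ) • (Affine.Point.some _ _ h : (W.baseChange L).toAffine.Point) ≠ 0 :=
    fun e => by have := hmul 8 e; omega
  -- `2P = (x₁, y₁)` and `4P = (x₂, y₂)` are affine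
  obtain ⟨x₁, y₁, h₁, hQ⟩ : ∃ x₁ y₁ h₁, (Affine.Point.some _ _ h : (W.baseChange
      L).toAffine.Point) + .some _ _ h = .some x₁ y₁ h₁ := by
    rcases hPP : (Affine.Point.some _ _ h : (W.baseChange L).toAffine.Point) + .some _ _ h with
        _ | ⟨x₁, y₁, h₁⟩
    · exact absurd (by rw [two_nsmul, hPP, ← Affine.Point.zero_def]) h2P
    · exact ⟨x₁, y₁, h₁, hPP⟩
  have e4 : (4 : ℕ) • (Affine.Point.some _ _ h : (W.baseChange L).toAffine.Point) =
      (.some _ _ h + .some _ _ h) + (.some _ _ h + .some _ _ h) := by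
    abel
  obtain ⟨x₂, y₂, h₂, hR⟩ : ∃ x₂ y₂ h₂, (Affine.Point.some _ _ h₁ : (W.baseChange
      L).toAffine.Point) + .some _ _ h₁ = .some x₂ y₂ h₂ := by
    rcases hQQ : (Affine.Point.some _ _ h₁ : (W.baseChange L).toAffine.Point) + .some _ _ h₁ with
        _ | ⟨x₂, y₂, h₂⟩
    · exact absurd (by rw [e4, hQ, hQQ, ← Affine.Point.zero_def]) h4P
    · exact ⟨x₂, y₂, h₂, hQQ⟩
  -- `P ≠ -P`, `2P ≠ -2P`, `4P ≠ -4P`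
  have hy : y₀ ≠ (W.baseChange L).toAffine.negY x₀ y₀ := fun hyy =>
    h2P (by rw [two_nsmul]; exact Affine.Point.add_self_of_Y_eq hyy)
  have hy₁ : y₁ ≠ (W.baseChange L).toAffine.negY x₁ y₁ := fun hyy =>
    h4P (by rw [e4, hQ]; exact Affine.Point.add_self_of_Y_eq hyy)
  have e8 : (8 : ℕ) • (Affine.Point.some _ _ h : (W.baseChange L).toAffine.Point) =
      ((.some _ _ h + .some _ _ h) + (.some _ _ h + .some _ _ h)) +
        ((.some _ _ h + .some _ _ h) + (.some _ _ h + .some _ _ h)) := by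
    abel
  have hy₂ : y₂ ≠ (W.baseChange L).toAffine.negY x₂ y₂ := fun hyy =>
    h8P (by rw [e8, hQ, hR]; exact Affine.Point.add_self_of_Y_eq hyy)
  -- Tate's coordinate at `P` (`d₀`), `2P` (`d₁ = (d₀-1)/d₀`) and `4P` (`d₂ = (d₁-1)/d₁`)
  have h7Q : (7 : ℕ) • (Affine.Point.some _ _ h₁ : (W.baseChange L).toAffine.Point) = 0 := by
    rw [← hQ, nsmul_add, h7P, add_zero]
  obtain ⟨hd0, hd1, hdQ, hD, hj, -⟩ :=
    tateSeven_of_order_seven (V := W.baseChange L) h7P hQ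
  obtain ⟨hd0', hd1', hdR, -⟩ :=
    tateSeven_of_order_seven (V := W.baseChange L) h7Q hR
  -- Galois moves `d(P)` within `{d₀, d₁, d₂}`
  have hT : ∀ σ : L ≃ₐ[F] L,
      σ ((W.baseChange L).tateSeven x₀ y₀) = (W.baseChange L).tateSeven x₀ y₀ ∨
      σ ((W.baseChange L).tateSeven x₀ y₀) = (W.baseChange L).tateSeven x₁ y₁ ∨
      σ ((W.baseChange L).tateSeven x₀ y₀) = (W.baseChange L).tateSeven x₂ y₂ := by
    intro σ
    have key := map_tateSeven (W := W) (σ : L →ₐ[F] L) x₀ y₀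
    rw [AlgEquiv.coe_toAlgHom] at key
    rw [key]
    -- `σP = mP`, `m = n mod 7 ∈ {0, …, 6}`
    obtain ⟨n, hn⟩ := AddSubgroup.mem_zmultiples_iff.mp (hσ σ)
    have hmod := mod_addOrderOf_zsmul
      (Affine.Point.some _ _ h : (W.baseChange L).toAffine.Point) n
    rw [h7, hn] at hmod
    push_cast at hmod
    have h0n : 0 ≤ n % 7 := Int.emod_nonneg _ (by norm_num)
    have h7n : n % 7 < 7 := Int.emod_lt_of_pos _ (by norm_num)
    -- coordinates of `σP` from an equation `σP = (x', y')`
    have coords : ∀ {x' y' : L} {h' : (W.baseChange L).toAffine.Nonsingular x' y'},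
        σ • (Affine.Point.some _ _ h : (W.baseChange L).toAffine.Point) = .some _ _ h' →
          σ x₀ = x' ∧ σ y₀ = y' := by
      intro x' y' h' hσP
      change Affine.Point.map (σ : L →ₐ[F] L) (Affine.Point.some _ _ h) = _ at hσP
      rw [Affine.Point.map_some] at hσP
      simpa only [Affine.Point.some.injEq, AlgEquiv.coe_toAlgHom] using hσP
    generalize n % 7 = m at hmod h0n h7n
    interval_cases m
    · -- `σP = O`: impossible
      rw [zero_zsmul] at hmod
      exact absurd ((smul_eq_zero_iff_eq σ).mp hmod.symm) (Affine.Point.some_ne_zero h)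
    · -- `σP = P`
      rw [one_zsmul] at hmod
      obtain ⟨hx, hy'⟩ := coords hmod.symm
      exact Or.inl (by rw [hx, hy'])
    · -- `σP = 2P`
      rw [two_zsmul, hQ] at hmod
      obtain ⟨hx, hy'⟩ := coords hmod.symm
      exact Or.inr (Or.inl (by rw [hx, hy']))
    · -- `σP = 3P = -4P`
      have e3 : (3 : ℕ) • (Affine.Point.some _ _ h : (W.baseChange L).toAffine.Point) =
          -.some _ _ h₂ := by
        rw [eq_neg_iff_add_eq_zero, ← hR, ← hQ, ← e4, ← add_nsmul]
        exact h7P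
      rw [ofNat_zsmul, e3, Affine.Point.neg_some] at hmod
      obtain ⟨hx, hy'⟩ := coords hmod.symm
      exact Or.inr (Or.inr (by rw [hx, hy', tateSeven_negY hy₂]))
    · -- `σP = 4P`
      rw [ofNat_zsmul, e4, hQ, hR] at hmod
      obtain ⟨hx, hy'⟩ := coords hmod.symm
      exact Or.inr (Or.inr (by rw [hx, hy']))
    · -- `σP = 5P = -2P`
      have e5 : (5 : ℕ) • (Affine.Point.some _ _ h : (W.baseChange L).toAffine.Point) =
          -.some _ _ h₁ := by
        rw [eq_neg_iff_add_eq_zero, ← hQ, ← two_nsmul, ← add_nsmul]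
        exact h7P
      rw [ofNat_zsmul, e5, Affine.Point.neg_some] at hmod
      obtain ⟨hx, hy'⟩ := coords hmod.symm
      exact Or.inr (Or.inl (by rw [hx, hy', tateSeven_negY hy₁]))
    · -- `σP = 6P = -P`
      have e6 : (6 : ℕ) • (Affine.Point.some _ _ h : (W.baseChange L).toAffine.Point) =
          -.some _ _ h := by
        rw [eq_neg_iff_add_eq_zero, ← succ_nsmul]
        exact h7P
      rw [ofNat_zsmul, e6, Affine.Point.neg_some] at hmod
      obtain ⟨hx, hy'⟩ := coords hmod.symm
      exact Or.inl (by rw [hx, hy', tateSeven_negY hy])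
  -- hence `η = (d³ - 8d² + 5d + 1)/(d(d-1))` is Galois invariant
  revert hd0 hd1 hdQ hD hj hd0' hd1' hdR hT
  generalize (W.baseChange L).tateSeven x₀ y₀ = u
  generalize (W.baseChange L).tateSeven x₁ y₁ = v
  generalize (W.baseChange L).tateSeven x₂ y₂ = w
  intro hd0 hd1 hdQ hD hj hd0' hd1' hdR hT
  have hfix : ∀ σ : L ≃ₐ[F] L,
      σ ((u ^ 3 - 8 * u ^ 2 + 5 * u + 1) / (u * (u - 1))) =
        (u ^ 3 - 8 * u ^ 2 + 5 * u + 1) / (u * (u - 1)) := by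
    intro σ
    simp only [map_div₀, map_mul, map_add, map_sub, map_pow, map_one, map_ofNat]
    rcases hT σ with e | e | e
    · rw [e]
    · rw [e, hdQ]
      exact hauptmodul_seven_eq_of_double hd0 hd1
    · rw [e, hdR, hauptmodul_seven_eq_of_double hd0' hd1', hdQ]
      exact hauptmodul_seven_eq_of_double hd0 hd1
  obtain ⟨g, hg⟩ := (InfiniteGalois.mem_range_algebraMap_iff_fixed _).mpr hfix
  have hjH := j_mul_hauptmodul_seven hd0 hd1 hD hj
  refine ⟨g, ?_, ?_⟩
  · apply (algebraMap F L).injective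
    have hjL : algebraMap F L W.j = (W.baseChange L).j := (W.map_j _).symm
    simp only [map_mul, map_add, map_pow, map_ofNat, map_one, hjL, hg]
    exact hjH
  · rw [hg, div_mul_cancel₀ _ (mul_ne_zero hd0 hd1)]

/-- **Klein–Fricke at level `7` from a torsion point, with the value of the Hauptmodul** (the
form consumed by the level-`49` step of Kenku's theorem). For `W/F` elliptic, `L/F` Galois and
`P = (x, y) ∈ W(L)` of order `7` with `Gal(L/F)`-stable `ℤP`: the tangent-normalised coefficients
`A₁, A₂, A₃` of `W_L` at `P` satisfy `A₂A₃(A₃ - A₁A₂) ≠ 0` and have Kubert's shape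
`A₁ = u(1 - d(d-1))`, `A₂ = -u²d²(d-1)`, `A₃ = -u³d²(d-1)` (`d = -A₂³/(A₃(A₃ - A₁A₂))` Tate's
parameter, `u = A₃/A₂`, `d(d-1) ≠ 0`), and there is `η ∈ F` with
`j(W) · η = (η² + 13η + 49)(η² + 5η + 1)³` and `η · d(d-1) = d³ - 8d² + 5d + 1`.
[cite: Kubert1976, Table 3 (N = 7)] -/
theorem hauptmodul_seven_of_torsion_some [IsGalois F L] [W.IsElliptic] {x y : L}
    {h : (W.baseChange L).toAffine.Nonsingular x y}
    (h7 : addOrderOf (Affine.Point.some x y h : (W.baseChange L).toAffine.Point) = 7)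
    (hσ : ∀ σ : L ≃ₐ[F] L, σ • (Affine.Point.some x y h : (W.baseChange L).toAffine.Point) ∈
      AddSubgroup.zmultiples (Affine.Point.some x y h : (W.baseChange L).toAffine.Point)) :
    (W.baseChange L).tgA₂ x y ≠ 0 ∧ (W.baseChange L).tgA₃ x y ≠ 0 ∧
      (W.baseChange L).tgA₃ x y - (W.baseChange L).tgA₁ x y * (W.baseChange L).tgA₂ x y ≠ 0 ∧
      ∀ d u : L,
        d = -(W.baseChange L).tgA₂ x y ^ 3 /
              ((W.baseChange L).tgA₃ x y *
                ((W.baseChange L).tgA₃ x y -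
                  (W.baseChange L).tgA₁ x y * (W.baseChange L).tgA₂ x y)) →
        u = (W.baseChange L).tgA₃ x y / (W.baseChange L).tgA₂ x y →
        d ≠ 0 ∧ d - 1 ≠ 0 ∧
        (W.baseChange L).tgA₁ x y = u * (1 - d * (d - 1)) ∧
        (W.baseChange L).tgA₂ x y = -(u ^ 2 * (d ^ 2 * (d - 1))) ∧
        (W.baseChange L).tgA₃ x y = -(u ^ 3 * (d ^ 2 * (d - 1))) ∧
        ∃ η : F, W.j * η = (η ^ 2 + 13 * η + 49) * (η ^ 2 + 5 * η + 1) ^ 3 ∧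
          algebraMap F L η * (d * (d - 1)) = d ^ 3 - 8 * d ^ 2 + 5 * d + 1 := by
  haveI : (W.baseChange L).IsElliptic := by rw [baseChange]; infer_instance
  have h7P : (7 : ℕ) • (Affine.Point.some _ _ h : (W.baseChange L).toAffine.Point) = 0 :=
    h7 ▸ addOrderOf_nsmul_eq_zero _
  have h2P : (2 : ℕ) • (Affine.Point.some _ _ h : (W.baseChange L).toAffine.Point) ≠ 0 :=
    fun e => by have := h7 ▸ addOrderOf_dvd_of_nsmul_eq_zero e; omega
  obtain ⟨x₁, y₁, h₁, hQ⟩ : ∃ x₁ y₁ h₁, (Affine.Point.some _ _ h : (W.baseChange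
      L).toAffine.Point) + .some _ _ h = .some x₁ y₁ h₁ := by
    rcases hPP : (Affine.Point.some _ _ h : (W.baseChange L).toAffine.Point) + .some _ _ h with
        _ | ⟨x₁, y₁, h₁⟩
    · exact absurd (by rw [two_nsmul, hPP, ← Affine.Point.zero_def]) h2P
    · exact ⟨x₁, y₁, h₁, hPP⟩
  obtain ⟨hd0, hd1, -, -, -, h2, h3, hc0, ha₁, ha₂, ha₃⟩ :=
    tateSeven_of_order_seven (V := W.baseChange L) h7P hQ
  obtain ⟨η, hjη, hη⟩ := exists_hauptmodul_seven_of_torsion (W := W) h7 hσ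
  refine ⟨h2, h3, hc0, ?_⟩
  intro d u hd hu
  subst hd hu
  exact ⟨hd0, hd1, ha₁, ha₂, ha₃, η, hjη, hη⟩

/-- **A Galois-stable cyclic subgroup of order `7` gives an `F`-point of `X₀(7)`** (Klein–Fricke,
level `7`; point form). For `W/F` elliptic, `L/F` Galois and `P ∈ W(L)` of order `7` with
`Gal(L/F)`-stable `ℤP` there is `η ∈ F` with `j(W) · η = (η² + 13η + 49)(η² + 5η + 1)³`.
[cite: Maier2006, Table 4 (N = 7)] -/
theorem exists_hauptmodul_seven_of_torsion' [IsGalois F L] [W.IsElliptic]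
    {P : (W.baseChange L).toAffine.Point} (h7 : addOrderOf P = 7)
    (hσ : ∀ σ : L ≃ₐ[F] L, σ • P ∈ AddSubgroup.zmultiples P) :
    ∃ η : F, W.j * η = (η ^ 2 + 13 * η + 49) * (η ^ 2 + 5 * η + 1) ^ 3 := by
  rcases P with _ | ⟨x, y, h⟩
  · rw [← Affine.Point.zero_def, addOrderOf_zero] at h7
    omega
  · obtain ⟨η, hη, -⟩ := exists_hauptmodul_seven_of_torsion (W := W) h7 hσ
    exact ⟨η, hη⟩

/-- **A rational cyclic `7`-isogeny gives a rational point of `X₀(7)`.** Over a field `K` of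
characteristic `0`: if the elliptic curve `W/K` admits a `K`-rational isogeny with cyclic kernel
of order `7`, then `j(W) · η = (η² + 13η + 49)(η² + 5η + 1)³` for some `η ∈ K` (the kernel is
generated by a point `P ∈ W(K̄)` of order `7` with `Γ_K`-stable `ℤP`; apply
`exists_hauptmodul_seven_of_torsion'` with `L = K̄`). This is the level-`7` entry of Fricke's
list of rational modular equations, here without the restriction `j ≠ 0` of
`Isogeny.exists_j_eq_klein_seven_of_degree_eq_seven` and from first principles.
[cite: Maier2006, Table 4 (N = 7)] -/
theorem Isogeny.exists_hauptmodul_seven_of_isCyclic {K : Type u} [Field K] [CharZero K]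
    {W W' : WeierstrassCurve K} [W.IsElliptic] (φ : Isogeny W W') (hφ : φ.IsCyclic)
    (hdeg : φ.degree = 7) :
    ∃ η : K, W.j * η = (η ^ 2 + 13 * η + 49) * (η ^ 2 + 5 * η + 1) ^ 3 := by
  haveI : IsGalois K (AlgebraicClosure K) := {}
  haveI : IsAddCyclic φ.toAddMonoidHom.ker := hφ
  obtain ⟨g, hg⟩ := IsAddCyclic.exists_ofOrder_eq_natCard (α := φ.toAddMonoidHom.ker)
  have hordP : addOrderOf (g : W.geomPoints) = 7 := by
    rw [AddSubgroup.addOrderOf_coe, hg]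
    exact hdeg
  have hgen : AddSubgroup.zmultiples (g : W.geomPoints) = φ.toAddMonoidHom.ker := by
    apply AddSubgroup.eq_of_le_of_card_ge (AddSubgroup.zmultiples_le.mpr g.2)
    rw [Nat.card_zmultiples, hordP]
    exact hdeg.le
  have hg0 : φ (g : W.geomPoints) = 0 := (AddMonoidHom.mem_ker).mp g.2
  have hst : ∀ σ : Field.absoluteGaloisGroup K,
      σ • (g : W.geomPoints) ∈ AddSubgroup.zmultiples (g : W.geomPoints) := fun σ => by
    rw [hgen, AddMonoidHom.mem_ker, Isogeny.coe_toAddMonoidHom, φ.map_smul, hg0, smul_zero]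
  exact exists_hauptmodul_seven_of_torsion' (W := W) (L := AlgebraicClosure K)
    (P := (g : W.geomPoints)) hordP hst

end Descent

end WeierstrassCurve

end
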